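import Summits.Ventures.HodgeRepro2.InducedTypeMatrix

/-!
# InducedTypeSplitting — the linear algebra of T4-B4 Lemma B4.4 (= Lemma B3.6)

Sub-claim B4 (route/T4-B4-p1.md, owner p1) proves in Lemma B4.4 that an abelian variety of the
CM type `Φ̃ = {θ : θ|_K ∈ T}` induced from `(K, T)` to a CM field `M̃ ⊃ K` of relative degree `r`
is `K`-equivariantly isogenous to `A_T^r`.  The proof is linear algebra on the `σ`-blocks of the
embedding vector `u(x) = (θ(x))_θ`: writing `x = Σ_j x_j b_j` in a `K`-basis `b` of `M̃`,

  `(θ(x))_{θ|_K = σ} = C_σᵀ · (σ(x_j))_j`,   `C_σ := (θ(b_j))_{j, θ}`,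

`C_σ` is invertible (`det_embeddingsMatrixReindex_ne_zero`, InducedTypeMatrix.lean), and the
block map `Λ_σ := (C_σᵀ)⁻¹` carries `u_σ(⊕_j O_K b_j)` onto `σ(O_K)^r` and commutes with the
`K`-action, which on both sides is the scalar `σ(y)`.  This file records exactly these statements,
with `ℂ` a `K`-algebra through the embedding `σ = algebraMap K ℂ` (a general `[Algebra K ℂ]`
instance, so that `σ.toAlgebra` for every `σ : K →+* ℂ` is covered), the fibre `{θ : θ|_K = σ}`
being `L →ₐ[K] ℂ` (`fibreEquiv`), of cardinality `r = [L : K]` (`card_fibre`).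

Nothing about abelian varieties, complex tori or isogenies is formalised (T4-B4 GAPS, «not
formalised»); what is kernel-checked is the block identity, the invertibility of the block map,
the identity of lattices under it and its `K`-equivariance — the content of the displayed
computation in the proof of Lemma B4.4.
-/

namespace Summit.Ventures.HodgeRepro2

open Matrix

section Fibre

variable {K L : Type*} [Field K] [Field L] [Algebra K L] [Algebra K ℂ]

/-- The fibre `Φ̃_σ = {θ : L → ℂ : θ|_K = σ}` of the restriction map `Hom(L, ℂ) → Hom(K, ℂ)` over
`σ = algebraMap K ℂ` is the set of `K`-algebra homomorphisms `L →ₐ[K] ℂ` (T4-B4 Lemma B4.4: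
`Φ̃ = ⊔_{σ ∈ T} Φ̃_σ`; for `σ.toAlgebra` the condition reads `θ.comp (algebraMap K L) = σ`,
`comp_algebraMap_eq_iff`). -/
def fibreEquiv : {θ : L →+* ℂ // θ.comp (algebraMap K L) = algebraMap K ℂ} ≃ (L →ₐ[K] ℂ) where
  toFun θ := ⟨θ.1, fun r => RingHom.congr_fun θ.2 r⟩
  invFun φ := ⟨φ.toRingHom, RingHom.ext fun r => φ.commutes r⟩
  left_inv _ := Subtype.ext (RingHom.ext fun _ => rfl)
  right_inv _ := AlgHom.ext fun _ => rfl

/-- `fibreEquiv` does not change the underlying map `L → ℂ`. -/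
theorem fibreEquiv_apply_apply (θ : {θ : L →+* ℂ // θ.comp (algebraMap K L) = algebraMap K ℂ})
    (x : L) : fibreEquiv θ x = θ.1 x := rfl

/-- Each `σ` has exactly `r = [L : K]` extensions to `L` (`L/K` finite separable): the block size
of Lemma B4.4. -/
theorem card_fibre [FiniteDimensional K L] [Algebra.IsSeparable K L] :
    Fintype.card (L →ₐ[K] ℂ) = Module.finrank K L :=
  AlgHom.card K L ℂ

end Fibre

section Block

variable {ι : Type*} {K L : Type*} [Field K] [Field L] [Algebra K L]

/-- `𝔪′ = ⊕_j R b_j`: the elements of `L` whose `b`-coordinates lie in `R ⊆ K` (Lemma B4.4 takes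
`R = O_K`, the ring of integers). -/
def latticeOf (b : Module.Basis ι K L) (R : Set K) : Set L := {x | ∀ j, b.repr x j ∈ R}

/-- Membership in `latticeOf`, unfolded. -/
theorem mem_latticeOf_iff (b : Module.Basis ι K L) (R : Set K) (x : L) :
    x ∈ latticeOf b R ↔ ∀ j, b.repr x j ∈ R := Iff.rfl

variable [Algebra K ℂ]

/-- The `σ`-block of the embedding vector `u(x) = (θ(x))_θ`: its coordinates at the embeddings
`θ : L → ℂ` extending `σ = algebraMap K ℂ`, reindexed by `e : ι ≃ (L →ₐ[K] ℂ)`. -/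
def fibreVec (e : ι ≃ (L →ₐ[K] ℂ)) (x : L) : ι → ℂ := fun j => e j x

/-- The `σ`-images of the `K`-coordinates of `x` in the basis `b`: `(σ(x_j))_j`. -/
noncomputable def coordVec (b : Module.Basis ι K L) (x : L) : ι → ℂ :=
  fun j => algebraMap K ℂ (b.repr x j)

/-- `fibreVec`, unfolded. -/
theorem fibreVec_apply (e : ι ≃ (L →ₐ[K] ℂ)) (x : L) (j : ι) : fibreVec e x j = e j x := rfl

/-- `coordVec`, unfolded. -/
theorem coordVec_apply (b : Module.Basis ι K L) (x : L) (j : ι) :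
    coordVec b x j = algebraMap K ℂ (b.repr x j) := rfl

/-- The `K`-action on the `σ`-block of `u` is the scalar `σ(y)`: `u_σ(y • x) = σ(y) • u_σ(x)`. -/
theorem fibreVec_smul (e : ι ≃ (L →ₐ[K] ℂ)) (y : K) (x : L) :
    fibreVec e (y • x) = algebraMap K ℂ y • fibreVec e x := by
  funext j
  rw [fibreVec_apply, Pi.smul_apply, fibreVec_apply, smul_eq_mul, Algebra.smul_def, map_mul,
    AlgHom.commutes]

/-- The `K`-action on the coordinate side is the same scalar `σ(y)`. -/
theorem coordVec_smul (b : Module.Basis ι K L) (y : K) (x : L) :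
    coordVec b (y • x) = algebraMap K ℂ y • coordVec b x := by
  funext j
  rw [coordVec_apply, Pi.smul_apply, coordVec_apply, smul_eq_mul, map_smul, Finsupp.smul_apply,
    smul_eq_mul, map_mul]

/-- The `σ`-block of `u` is injective on `L` (an embedding is injective), so the `σ`-blocks already
determine `x`; Lemma B4.4 uses the isomorphism of tori, not this. -/
theorem fibreVec_injective [Nonempty ι] (e : ι ≃ (L →ₐ[K] ℂ)) :
    Function.Injective (fibreVec e : L → ι → ℂ) := by
  intro x y h
  obtain ⟨j⟩ := ‹Nonempty ι›
  have := congr_fun h j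
  rw [fibreVec_apply, fibreVec_apply] at this
  exact (e j).injective this

variable [Fintype ι]

omit [Algebra K ℂ] in
/-- `Σ_j c_j b_j ∈ 𝔪′` when every `c_j ∈ R`. -/
theorem sum_smul_mem_latticeOf (b : Module.Basis ι K L) (R : Set K) (c : ι → K)
    (hc : ∀ j, c j ∈ R) : (∑ j, c j • b j) ∈ latticeOf b R := by
  intro j
  rw [b.repr_sum_self]
  exact hc j

/-- The coordinate vector of `Σ_j c_j b_j` is `(σ(c_j))_j`. -/
theorem coordVec_sum_smul (b : Module.Basis ι K L) (c : ι → K) :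
    coordVec b (∑ j, c j • b j) = fun j => algebraMap K ℂ (c j) := by
  funext j
  rw [coordVec_apply, b.repr_sum_self]

/-- An embedding extending `σ` evaluates `x = Σ_j x_j b_j` to `Σ_j σ(x_j) θ(b_j)`. -/
theorem algHom_apply_eq_sum (b : Module.Basis ι K L) (θ : L →ₐ[K] ℂ) (x : L) :
    θ x = ∑ j, algebraMap K ℂ (b.repr x j) * θ (b j) := by
  conv_lhs => rw [← b.sum_repr x]
  rw [map_sum]
  refine Finset.sum_congr rfl fun j _ => ?_
  rw [Algebra.smul_def, map_mul, AlgHom.commutes]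

/-- THE BLOCK IDENTITY of Lemma B4.4: `(θ(x))_{θ|_K = σ} = C_σᵀ ⬝ (σ(x_j))_j`, where
`C_σ = Algebra.embeddingsMatrixReindex K ℂ b e` has entries `C_σ j θ = (e θ)(b j)` (rows = basis,
columns = embeddings, Mathlib's convention). -/
theorem fibreVec_eq_mulVec (b : Module.Basis ι K L) (e : ι ≃ (L →ₐ[K] ℂ)) (x : L) :
    fibreVec e x = (Algebra.embeddingsMatrixReindex K ℂ b e).transpose.mulVec (coordVec b x) := by
  funext j
  rw [fibreVec_apply, algHom_apply_eq_sum b (e j) x]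
  simp only [Matrix.mulVec, dotProduct, transpose_apply, Algebra.embeddingsMatrixReindex,
    reindex_apply, submatrix_apply, Algebra.embeddingsMatrix, of_apply, Equiv.refl_symm,
    Equiv.coe_refl, id, Equiv.symm_symm, coordVec_apply]
  exact Finset.sum_congr rfl fun i _ => mul_comm _ _

variable [DecidableEq ι] [Module.Finite K L] [Algebra.IsSeparable K L]

/-- `C_σᵀ` is invertible: `det C_σ ≠ 0` (`det_embeddingsMatrixReindex_ne_zero`, the discriminant
of a basis of a separable extension). -/
theorem isUnit_det_transpose (b : Module.Basis ι K L) (e : ι ≃ (L →ₐ[K] ℂ)) :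
    IsUnit (Algebra.embeddingsMatrixReindex K ℂ b e).transpose.det := by
  rw [det_transpose, isUnit_iff_ne_zero]
  convert det_embeddingsMatrixReindex_ne_zero K ℂ b e using 2
  rfl

/-- The block map `Λ_σ = (C_σᵀ)⁻¹` of Lemma B4.4, as a `ℂ`-linear automorphism of `ι → ℂ`
(the `σ`-block `ℂ^{Φ̃_σ} → ℂ^r`). -/
noncomputable def blockEquiv (b : Module.Basis ι K L) (e : ι ≃ (L →ₐ[K] ℂ)) :
    (ι → ℂ) ≃ₗ[ℂ] (ι → ℂ) :=
  (Matrix.toLinearEquiv' (Algebra.embeddingsMatrixReindex K ℂ b e).transpose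
    (Matrix.invertibleOfIsUnitDet _ (isUnit_det_transpose b e))).symm

/-- `Λ_σ` turns the `σ`-block of `u(x)` into the `σ`-images of the coordinates of `x`:
`Λ_σ (θ(x))_θ = (σ(x_j))_j`. -/
theorem blockEquiv_fibreVec (b : Module.Basis ι K L) (e : ι ≃ (L →ₐ[K] ℂ)) (x : L) :
    blockEquiv b e (fibreVec e x) = coordVec b x := by
  rw [blockEquiv, LinearEquiv.symm_apply_eq]
  exact fibreVec_eq_mulVec b e x

/-- Conversely `Λ_σ⁻¹ (σ(x_j))_j = (θ(x))_θ`. -/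
theorem blockEquiv_symm_coordVec (b : Module.Basis ι K L) (e : ι ≃ (L →ₐ[K] ℂ)) (x : L) :
    (blockEquiv b e).symm (coordVec b x) = fibreVec e x := by
  rw [LinearEquiv.symm_apply_eq, blockEquiv_fibreVec]

/-- THE LATTICE IDENTITY of Lemma B4.4 on the `σ`-block: `Λ_σ(u_σ(𝔪′)) = σ(R)^r`, i.e. the block
map carries the `σ`-block of the lattice `u(⊕_j R b_j)` onto the product lattice
`(σ(R))^ι` — with `R = O_K` and `T ∋ σ` this is `Λ(u(𝔪′)) = u_T(O_K)^r`. -/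
theorem image_blockEquiv_fibreVec_latticeOf (b : Module.Basis ι K L) (e : ι ≃ (L →ₐ[K] ℂ))
    (R : Set K) :
    (fun x => blockEquiv b e (fibreVec e x)) '' latticeOf b R =
      Set.univ.pi fun _ : ι => algebraMap K ℂ '' R := by
  ext v
  constructor
  · rintro ⟨x, hx, rfl⟩ j _
    show blockEquiv b e (fibreVec e x) j ∈ algebraMap K ℂ '' R
    rw [blockEquiv_fibreVec, coordVec_apply]
    exact ⟨_, hx j, rfl⟩
  · intro hv
    choose c hc using fun j => hv j (Set.mem_univ j)
    refine ⟨∑ j, c j • b j, sum_smul_mem_latticeOf b R c fun j => (hc j).1, ?_⟩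
    show blockEquiv b e (fibreVec e _) = v
    rw [blockEquiv_fibreVec, coordVec_sum_smul]
    funext j
    exact (hc j).2

/-- `K`-EQUIVARIANCE of the block map (Lemma B4.4, «it is `K`-equivariant: `y ∈ K` acts on the
block `ℂ^{Φ̃_σ}` and on the `σ`-coordinate of each copy of `ℂ^T` by the same scalar `σ(y)`, which
commutes with `C_σ⁻¹`»). -/
theorem blockEquiv_fibreVec_smul (b : Module.Basis ι K L) (e : ι ≃ (L →ₐ[K] ℂ)) (y : K) (x : L) :
    blockEquiv b e (fibreVec e (y • x)) = algebraMap K ℂ y • blockEquiv b e (fibreVec e x) := by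
  rw [fibreVec_smul, map_smul]

end Block

end Summit.Ventures.HodgeRepro2
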